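import Literature.AlgebraicGeometry.Resolution.SymbolicPowersRsop
import Literature.AlgebraicGeometry.Resolution.RsopMonomialIdeals
import Mathlib.RingTheory.Filtration
import Mathlib.RingTheory.MvPolynomial.Homogeneous
import Mathlib.Algebra.MvPolynomial.Variables
import HarnessLib

/-!
# Nested ideals generated by parts of ONE regular system of parameters: `𝔮 ∩ Pᴺ = 𝔮·Pᴺ⁻¹`

OURS (campaign res-hironaka, rung L ★L-G4, slot W4.1, crux `Steer` stmt-ResolutionOfSingularities-16345; res-L0-w41-plan-1
RULING 42 (A2) «run-threading» := res-L0-w41-stub-3 g6; replaces the role of no printed item; NOT a statement of the manuscript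
under review [claim: Hironaka2017, status: under-review]; AI review is weaker than expert review). Theses-free, definition-free.

THE ALGEBRA LEMMA behind the threading of the LOW tower through ONE local ring `Λ = (R i₀)_{𝔮₀}`: in a regular local ring,
for ideals `𝔮 = (y₁, …, y_a) ⊆ P = (y₁, …, y_a, y_{a+1}, …, y_{a+b})` generated by nested parts of ONE regular system of
parameters,
  `𝔮 ∩ P^{M+1} = 𝔮 · P^M`  (`span_inf_pow_succ_eq_mul_pow`),
and in particular `(z) ∩ 𝔪^{M+1} = (z)·𝔪^M` for any part `z` of a regular system of parameters (`span_inf_maximalIdeal_pow_succ_eq`).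
Proof (Rees / Matsumura Thm. 16.2): a form `F(y)` of degree `M+1` lying in `𝔮` splits as the monomials touching a variable of `𝔮`
(in `𝔮·P^M`) plus a form `G` in the remaining variables with `G(y) ∈ 𝔮`; modulo `𝔮` the remaining variables stay an `A`-sequence
(the ideals `(y_i : i ∈ U)` are prime, `RegularSystemOfParameters`), hence quasi-regular (`QuasiRegularSequences`), so the
coefficients of `G` lie in `P` and `G(y) ∈ P^{M+2}`; iterate and close with Krull's intersection theorem `⋂ₖ (I + 𝔪ᵏ) = I`.

Consumer: `…SteerCriticalThreadStep` (the step `R n ≤ Λ ⇒ R (n+1) ≤ Λ` of (A2)). [cite: Matsumura1987, Thm. 16.2, Thm. 17.8, Thm. 8.10]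
-/

noncomputable section

-- single-problem summit: the doubled namespace component `ResolutionOfSingularities` is forced
set_option linter.dupNamespace false

namespace Summit.ResolutionOfSingularities.ResolutionOfSingularities.Theorems.SwitchingDichotomy.RsopNested

open IsLocalRing MvPolynomial
open Literature.AlgebraicGeometry.Resolution

universe u

variable {R : Type u} [CommRing R]

/-! ## Krull: ideals are closed -/

/-- **Krull's intersection theorem, closedness form**: in a Noetherian local ring `⋂ₖ (I + 𝔪ᵏ) = I`.
[cite: Matsumura1987, Thm. 8.10] -/
theorem iInf_sup_maximalIdeal_pow_eq [IsLocalRing R] [IsNoetherianRing R] (I : Ideal R) :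
    ⨅ k : ℕ, (I ⊔ maximalIdeal R ^ k) = I := by
  refine le_antisymm (fun c hc => ?_) (le_iInf fun k => le_sup_left)
  by_cases hI : I = ⊤
  · rw [hI]; trivial
  haveI : Nontrivial (R ⧸ I) := Ideal.Quotient.nontrivial_iff.mpr hI
  haveI : IsLocalRing (R ⧸ I) :=
    IsLocalRing.of_surjective' (Ideal.Quotient.mk I) Ideal.Quotient.mk_surjective
  have hmax : (maximalIdeal R).map (Ideal.Quotient.mk I) = maximalIdeal (R ⧸ I) :=
    IsLocalRing.map_maximalIdeal_of_surjective (Ideal.Quotient.mk I) Ideal.Quotient.mk_surjective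
  have hK := Ideal.iInf_pow_eq_bot_of_isLocalRing (maximalIdeal (R ⧸ I)) (maximalIdeal.isMaximal _).ne_top
  have hmem : Ideal.Quotient.mk I c ∈ ⨅ k : ℕ, maximalIdeal (R ⧸ I) ^ k := by
    refine Ideal.mem_iInf.mpr fun k => ?_
    have hk : c ∈ I ⊔ maximalIdeal R ^ k := Ideal.mem_iInf.mp hc k
    have hmap : (I ⊔ maximalIdeal R ^ k).map (Ideal.Quotient.mk I) = maximalIdeal (R ⧸ I) ^ k := by
      rw [Ideal.map_sup, Ideal.map_pow, Ideal.map_quotient_self, bot_sup_eq, hmax]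
    rw [← hmap]
    exact Ideal.mem_map_of_mem _ hk
  rw [hK] at hmem
  exact Ideal.Quotient.eq_zero_iff_mem.mp hmem

/-! ## The nested-intersection lemma for a regular system of parameters -/

section Rsop

variable [IsRegularLocalRing R] {d : ℕ} (hd : (maximalIdeal R).spanFinrank = d) (x : Fin d → R)
  (hx : Ideal.span (Set.range x) = maximalIdeal R)
  {a b : ℕ} (e : Fin (a + b) → Fin d) (he : Function.Injective e)

omit [IsRegularLocalRing R] in
/-- The finset of indices «all of the first block, and the members `< i` of the second block». [folklore] -/
private theorem span_first_sup_span_Iio_eq (i : Fin b) :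
    Ideal.span (Set.range (x ∘ e ∘ Fin.castAdd b)) ⊔ Ideal.span ((x ∘ e ∘ Fin.natAdd a) '' Set.Iio i) =
      Ideal.span (x '' ((Finset.univ.image (e ∘ Fin.castAdd b) ∪ (Finset.Iio i).image (e ∘ Fin.natAdd a) :
        Finset (Fin d)) : Set (Fin d))) := by
  classical
  apply le_antisymm
  · refine sup_le (Ideal.span_le.mpr ?_) (Ideal.span_le.mpr ?_)
    · rintro _ ⟨j, rfl⟩
      exact Ideal.subset_span ⟨e (Fin.castAdd b j), by simp, rfl⟩
    · rintro _ ⟨j, hj, rfl⟩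
      refine Ideal.subset_span ⟨e (Fin.natAdd a j), ?_, rfl⟩
      simp only [Finset.coe_union, Finset.coe_image, Finset.coe_univ, Set.image_univ, Finset.coe_Iio,
        Set.mem_union, Set.mem_range, Function.comp_apply, Set.mem_image, Set.mem_Iio]
      exact Or.inr ⟨j, hj, rfl⟩
  · refine Ideal.span_le.mpr ?_
    rintro _ ⟨t, ht, rfl⟩
    simp only [Finset.coe_union, Finset.coe_image, Finset.coe_univ, Set.image_univ, Finset.coe_Iio,
      Set.mem_union, Set.mem_range, Function.comp_apply, Set.mem_image, Set.mem_Iio] at ht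
    rcases ht with ⟨j, rfl⟩ | ⟨j, hj, rfl⟩
    · exact Ideal.mem_sup_left (Ideal.subset_span ⟨j, rfl⟩)
    · exact Ideal.mem_sup_right (Ideal.subset_span ⟨j, hj, rfl⟩)

include hd hx he in
/-- **Modulo the first block, the second block is still an `A`-sequence**: with `q = (y_j : j < a)` and
`z_i = y_{a+i}`, `z_i · w ∈ (z_j : j < i) + q` implies `w ∈ (z_j : j < i) + q` (the ideals `(x_t : t ∈ U)` are prime and
miss the other members). [cite: Matsumura1987, Thm. 17.8] -/
theorem regularSeq_second_block_mod_first (i : Fin b) (w : R ⧸ Ideal.span (Set.range (x ∘ e ∘ Fin.castAdd b)))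
    (hw : (Ideal.Quotient.mk _ ∘ (x ∘ e ∘ Fin.natAdd a)) i * w ∈
      Ideal.span ((Ideal.Quotient.mk (Ideal.span (Set.range (x ∘ e ∘ Fin.castAdd b))) ∘ (x ∘ e ∘ Fin.natAdd a)) ''
        Set.Iio i)) :
    w ∈ Ideal.span ((Ideal.Quotient.mk (Ideal.span (Set.range (x ∘ e ∘ Fin.castAdd b))) ∘ (x ∘ e ∘ Fin.natAdd a)) ''
      Set.Iio i) := by
  classical
  obtain ⟨w, rfl⟩ := Ideal.Quotient.mk_surjective w
  -- the target ideal downstairs is the image of `(z_j : j < i)`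
  have hmapI : Ideal.span ((Ideal.Quotient.mk (Ideal.span (Set.range (x ∘ e ∘ Fin.castAdd b))) ∘
      (x ∘ e ∘ Fin.natAdd a)) '' Set.Iio i) =
      (Ideal.span ((x ∘ e ∘ Fin.natAdd a) '' Set.Iio i)).map
        (Ideal.Quotient.mk (Ideal.span (Set.range (x ∘ e ∘ Fin.castAdd b)))) := by
    rw [Ideal.map_span, ← Set.image_comp]
  have hcomap : ((Ideal.span ((x ∘ e ∘ Fin.natAdd a) '' Set.Iio i)).map
      (Ideal.Quotient.mk (Ideal.span (Set.range (x ∘ e ∘ Fin.castAdd b))))).comap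
      (Ideal.Quotient.mk (Ideal.span (Set.range (x ∘ e ∘ Fin.castAdd b)))) =
      Ideal.span (Set.range (x ∘ e ∘ Fin.castAdd b)) ⊔ Ideal.span ((x ∘ e ∘ Fin.natAdd a) '' Set.Iio i) := by
    rw [Ideal.comap_map_of_surjective _ Ideal.Quotient.mk_surjective, ← RingHom.ker_eq_comap_bot,
      Ideal.mk_ker, sup_comm]
  -- upstairs: `z i * w ∈ q + (z_j : j < i) = (x_t : t ∈ U)`, a prime missing `z i`
  have hUeq := span_first_sup_span_Iio_eq x e i
  have hup : (x ∘ e ∘ Fin.natAdd a) i * w ∈ Ideal.span (x '' ((Finset.univ.image (e ∘ Fin.castAdd b) ∪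
      (Finset.Iio i).image (e ∘ Fin.natAdd a) : Finset (Fin d)) : Set (Fin d))) := by
    rw [← hUeq, ← hcomap, Ideal.mem_comap, map_mul, ← hmapI]
    exact hw
  have hnot : e (Fin.natAdd a i) ∉ ((Finset.univ.image (e ∘ Fin.castAdd b) ∪
      (Finset.Iio i).image (e ∘ Fin.natAdd a) : Finset (Fin d)) : Set (Fin d)) := by
    simp only [Finset.coe_union, Finset.coe_image, Finset.coe_univ, Set.image_univ, Finset.coe_Iio,
      Set.mem_union, Set.mem_range, Function.comp_apply, Set.mem_image, Set.mem_Iio, not_or, not_exists,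
      not_and]
    refine ⟨fun j hj => ?_, fun j hj hji => ?_⟩
    · have hv := congrArg Fin.val (he hj)
      simp only [Fin.val_castAdd, Fin.val_natAdd] at hv
      omega
    · have hv := congrArg Fin.val (he hji)
      simp only [Fin.val_natAdd] at hv
      have : j = i := Fin.ext (by omega)
      exact absurd this (ne_of_lt hj)
  have hprime := isPrime_span_image hd x hx
    (Finset.univ.image (e ∘ Fin.castAdd b) ∪ (Finset.Iio i).image (e ∘ Fin.natAdd a))
  have hzi : (x ∘ e ∘ Fin.natAdd a) i ∉ Ideal.span (x '' ((Finset.univ.image (e ∘ Fin.castAdd b) ∪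
      (Finset.Iio i).image (e ∘ Fin.natAdd a) : Finset (Fin d)) : Set (Fin d))) :=
    not_mem_span_image_of_not_mem hd x hx hnot
  have hwU := (hprime.mem_or_mem hup).resolve_left hzi
  -- back downstairs
  rw [← hUeq, ← hcomap, Ideal.mem_comap, ← hmapI] at hwU
  exact hwU

include hd hx he in
/-- Hence the second block is QUASI-REGULAR modulo the first (Rees, Matsumura Thm. 16.2 (i)). [cite: Matsumura1987, Thm. 16.2] -/
theorem isQuasiRegular_second_block_mod_first :
    IsQuasiRegular (Ideal.Quotient.mk (Ideal.span (Set.range (x ∘ e ∘ Fin.castAdd b))) ∘ (x ∘ e ∘ Fin.natAdd a)) :=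
  isQuasiRegular_of_regularSeq b _ (regularSeq_second_block_mod_first hd x hx e he)

include hd hx he in
/-- **One layer**: `𝔮 ∩ P^{M+1} ⊆ 𝔮·P^M + P^{M+2}` for `𝔮 =` (first block), `P =` (both blocks). [cite: Matsumura1987, Thm. 16.2] -/
theorem span_inf_pow_succ_le_mul_pow_sup :
    ∀ M : ℕ, Ideal.span (Set.range (x ∘ e ∘ Fin.castAdd b)) ⊓ Ideal.span (Set.range (x ∘ e)) ^ (M + 1) ≤
      Ideal.span (Set.range (x ∘ e ∘ Fin.castAdd b)) * Ideal.span (Set.range (x ∘ e)) ^ M ⊔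
        Ideal.span (Set.range (x ∘ e)) ^ (M + 2) := by
  classical
  intro M c hc
  obtain ⟨hcq, hcP⟩ := hc
  set y : Fin (a + b) → R := x ∘ e with hy
  set q : Ideal R := Ideal.span (Set.range (x ∘ e ∘ Fin.castAdd b)) with hq
  set z : Fin b → R := x ∘ e ∘ Fin.natAdd a with hz
  set P : Ideal R := Ideal.span (Set.range y) with hP
  have hzP : Ideal.span (Set.range z) ≤ P := by
    refine Ideal.span_mono ?_
    rintro _ ⟨j, rfl⟩; exact ⟨Fin.natAdd a j, rfl⟩
  have hqP : q ≤ P := by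
    refine Ideal.span_mono ?_
    rintro _ ⟨j, rfl⟩; exact ⟨Fin.castAdd b j, rfl⟩
  -- `c = F(y)` with `F` a form of degree `M + 1`
  obtain ⟨F, hF, hFc⟩ := exists_isHomogeneous_of_mem_span_pow y (M + 1) hcP
  -- split the monomials: those touching the first block / the others
  let touch : (Fin (a + b) →₀ ℕ) → Prop := fun m => ∃ j : Fin a, m (Fin.castAdd b j) ≠ 0
  set F₁ : MvPolynomial (Fin (a + b)) R := ∑ m ∈ F.support.filter touch, monomial m (F.coeff m) with hF₁
  set F₂ : MvPolynomial (Fin (a + b)) R := ∑ m ∈ F.support.filter (fun m => ¬ touch m), monomial m (F.coeff m)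
    with hF₂
  have hsplit : F = F₁ + F₂ := by
    rw [hF₁, hF₂, Finset.sum_filter_add_sum_filter_not]
    exact F.as_sum
  have hdeg : ∀ m ∈ F.support, m.degree = M + 1 := fun m hm => by
    rw [Finsupp.degree_eq_weight_one]; exact hF (mem_support_iff.mp hm)
  -- (i) the touching part lies in `q · P^M`
  have h₁ : eval y F₁ ∈ q * P ^ M := by
    rw [hF₁, map_sum]
    refine Ideal.sum_mem _ fun m hm => ?_
    obtain ⟨hmF, ⟨j, hj⟩⟩ := Finset.mem_filter.mp hm
    set s : Fin (a + b) →₀ ℕ := Finsupp.single (Fin.castAdd b j) 1 with hs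
    have hle : s ≤ m := by
      rw [hs, Finsupp.single_le_iff]; exact Nat.one_le_iff_ne_zero.mpr hj
    have hm_eq : s + (m - s) = m := add_tsub_cancel_of_le hle
    have hmon : monomial m (F.coeff m) = monomial s (1 : R) * monomial (m - s) (F.coeff m) := by
      rw [monomial_mul, one_mul, hm_eq]
    have hsdeg : s.degree = 1 := by rw [hs, Finsupp.degree_single]
    have hdeg' : (m - s).degree = M := by
      have h := hdeg m hmF
      rw [← hm_eq, map_add, hsdeg] at h
      omega
    rw [hmon, map_mul]
    refine Ideal.mul_mem_mul ?_ ?_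
    · have hev : eval y (monomial s (1 : R)) = y (Fin.castAdd b j) := by
        rw [hs, ← C_mul_X_pow_eq_monomial, map_mul, map_pow, eval_C, eval_X, one_mul, pow_one]
      rw [hev]
      exact Ideal.subset_span ⟨j, rfl⟩
    · exact eval_mem_span_pow y (isHomogeneous_monomial _ hdeg')
  -- (ii) the other part is a form `G` in the second block
  have hF₂coeff : ∀ m, F₂.coeff m = if m ∈ F.support.filter (fun m => ¬ touch m) then F.coeff m else 0 := by
    intro m
    rw [hF₂, coeff_sum]
    simp_rw [coeff_monomial]
    rw [Finset.sum_ite_eq']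
  have hvars : (↑F₂.vars : Set (Fin (a + b))) ⊆ Set.range (Fin.natAdd a) := by
    intro k hk
    rw [Finset.mem_coe, mem_vars_iff_mem_support] at hk
    obtain ⟨m, hm, hkm⟩ := hk
    have hm' : m ∈ F.support.filter (fun m => ¬ touch m) := by
      by_contra h
      rw [mem_support_iff, hF₂coeff m, if_neg h] at hm
      exact hm rfl
    obtain ⟨-, hnt⟩ := Finset.mem_filter.mp hm'
    induction k using Fin.addCases with
    | left j => exact absurd ⟨j, Finsupp.mem_support_iff.mp hkm⟩ hnt
    | right j => exact ⟨j, rfl⟩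
  obtain ⟨G, hG⟩ := exists_rename_eq_of_vars_subset_range F₂ (Fin.natAdd a) (Fin.natAdd_injective b a)
    hvars
  have hF₂hom : F₂.IsHomogeneous (M + 1) := by
    rw [hF₂]
    refine IsHomogeneous.sum _ _ _ fun m hm => isHomogeneous_monomial _ ?_
    exact hdeg m (Finset.mem_filter.mp hm).1
  have hGhom : G.IsHomogeneous (M + 1) := by
    rw [← IsHomogeneous.rename_isHomogeneous_iff (Fin.natAdd_injective b a), hG]; exact hF₂hom
  have hGeval : eval y F₂ = eval z G := by
    rw [← hG, eval_rename]; rfl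
  -- (iii) `G(z) ∈ q`
  have hGq : eval z G ∈ q := by
    have : eval z G = c - eval y F₁ := by
      rw [← hGeval, ← hFc, hsplit, map_add]; ring
    rw [this]
    exact q.sub_mem hcq (Ideal.mul_le_right h₁)
  -- (iv) modulo `q` the coefficients of `G` lie in `(z̄)`, hence the coefficients of `G` lie in `P`
  have hGbar : eval (Ideal.Quotient.mk q ∘ z) (MvPolynomial.map (Ideal.Quotient.mk q) G) = 0 := by
    have h1 : Ideal.Quotient.mk q (eval z G) = eval₂ (Ideal.Quotient.mk q) (Ideal.Quotient.mk q ∘ z) G := by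
      have := eval₂_comp_left (Ideal.Quotient.mk q) (RingHom.id R) z G
      rw [RingHom.comp_id] at this
      exact this
    rw [eval_map, ← h1]
    exact Ideal.Quotient.eq_zero_iff_mem.mpr hGq
  have hquasi := isQuasiRegular_second_block_mod_first hd x hx e he
  have hcoeff : ∀ m, G.coeff m ∈ P := by
    intro m
    have h := (isQuasiRegular_def _).mp hquasi (M + 1) (MvPolynomial.map (Ideal.Quotient.mk q) G)
      (hGhom.map _) (by rw [hGbar]; exact Ideal.zero_mem _) m
    rw [coeff_map] at h
    have hle : Ideal.span (Set.range (Ideal.Quotient.mk q ∘ (x ∘ e ∘ Fin.natAdd a))) ≤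
        (q ⊔ Ideal.span (Set.range z)).map (Ideal.Quotient.mk q) := by
      rw [Ideal.span_le]
      rintro _ ⟨j, rfl⟩
      exact Ideal.mem_map_of_mem _ (Ideal.mem_sup_right (Ideal.subset_span ⟨j, rfl⟩))
    have h2 := hle h
    rw [← Ideal.mem_comap, Ideal.comap_map_of_surjective _ Ideal.Quotient.mk_surjective,
      ← RingHom.ker_eq_comap_bot, Ideal.mk_ker] at h2
    exact (sup_le (sup_le hqP hzP) hqP) h2
  -- (v) so `G(z) ∈ P · (z)^{M+1} ⊆ P^{M+2}`
  have h₂ : eval z G ∈ P ^ (M + 2) := by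
    have hGP : G ∈ Ideal.map C P := by rw [mem_map_C_iff]; exact hcoeff
    have h := eval_mem_mul_span_pow z hGhom hGP
    rw [pow_succ']
    exact Ideal.mul_mono_right (Ideal.pow_right_mono hzP _) h
  -- (vi) assemble
  have hc_eq : c = eval y F₁ + eval z G := by rw [← hFc, hsplit, map_add, hGeval]
  rw [hc_eq]
  exact Ideal.add_mem _ (Ideal.mem_sup_left h₁) (Ideal.mem_sup_right h₂)

include hd hx he in
/-- **Iterated layers**: `𝔮 ∩ P^{M+1} ⊆ 𝔮·P^M + P^{M+1+k}` for every `k`. [cite: Matsumura1987, Thm. 16.2] -/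
theorem span_inf_pow_succ_le_mul_pow_sup_pow (M k : ℕ) :
    Ideal.span (Set.range (x ∘ e ∘ Fin.castAdd b)) ⊓ Ideal.span (Set.range (x ∘ e)) ^ (M + 1) ≤
      Ideal.span (Set.range (x ∘ e ∘ Fin.castAdd b)) * Ideal.span (Set.range (x ∘ e)) ^ M ⊔
        Ideal.span (Set.range (x ∘ e)) ^ (M + 1 + k) := by
  set q : Ideal R := Ideal.span (Set.range (x ∘ e ∘ Fin.castAdd b)) with hq
  set P : Ideal R := Ideal.span (Set.range (x ∘ e)) with hP
  induction k with
  | zero => exact fun c hc => Ideal.mem_sup_right (by simpa using hc.2)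
  | succ k ih =>
    intro c hc
    obtain ⟨u, hu, v, hv, huv⟩ := Submodule.mem_sup.mp (ih hc)
    have hvq : v ∈ q := by
      have : v = c - u := by rw [← huv]; ring
      rw [this]; exact q.sub_mem hc.1 (Ideal.mul_le_right hu)
    have hlayer := span_inf_pow_succ_le_mul_pow_sup hd x hx e he (M + k) ⟨hvq, by simpa [add_right_comm] using hv⟩
    obtain ⟨u', hu', v', hv', huv'⟩ := Submodule.mem_sup.mp hlayer
    rw [← huv, ← huv']
    refine Ideal.add_mem _ (Ideal.mem_sup_left hu) (Ideal.add_mem _ (Ideal.mem_sup_left ?_) (Ideal.mem_sup_right ?_))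
    · exact Ideal.mul_mono_right (Ideal.pow_le_pow_right (Nat.le_add_right M k)) hu'
    · simpa [show M + k + 2 = M + 1 + (k + 1) by omega] using hv'

include hd hx he in
/-- **`𝔮 ∩ P^{M+1} = 𝔮·P^M`** for `𝔮 = (x (e j) : j < a)` ⊆ `P = (x (e j) : all j)`, `x` a regular system of parameters of the
regular local ring `R`, `e` injective (nested parts of one regular system of parameters). [cite: Matsumura1987, Thm. 16.2] -/
theorem span_inf_pow_succ_eq_mul_pow_rsop (M : ℕ) :
    Ideal.span (Set.range (x ∘ e ∘ Fin.castAdd b)) ⊓ Ideal.span (Set.range (x ∘ e)) ^ (M + 1) =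
      Ideal.span (Set.range (x ∘ e ∘ Fin.castAdd b)) * Ideal.span (Set.range (x ∘ e)) ^ M := by
  set q : Ideal R := Ideal.span (Set.range (x ∘ e ∘ Fin.castAdd b)) with hq
  set P : Ideal R := Ideal.span (Set.range (x ∘ e)) with hP
  have hqP : q ≤ P := by
    refine Ideal.span_mono ?_
    rintro _ ⟨j, rfl⟩; exact ⟨Fin.castAdd b j, rfl⟩
  have hPm : P ≤ maximalIdeal R := by
    rw [hP, ← hx]
    refine Ideal.span_mono ?_
    rintro _ ⟨j, rfl⟩; exact ⟨e j, rfl⟩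
  refine le_antisymm (fun c hc => ?_) ?_
  · rw [← iInf_sup_maximalIdeal_pow_eq (q * P ^ M)]
    refine Ideal.mem_iInf.mpr fun k => ?_
    have h := span_inf_pow_succ_le_mul_pow_sup_pow hd x hx e he M k hc
    exact sup_le_sup_left ((Ideal.pow_right_mono hPm _).trans (Ideal.pow_le_pow_right (by omega))) _ h
  · refine le_inf Ideal.mul_le_right ?_
    rw [pow_succ']
    exact Ideal.mul_mono_left hqP

end Rsop

/-! ## `IsRsopPart` forms (what the threading consumes) -/

/-- **`𝔮 ∩ P^{M+1} = 𝔮·P^M` for nested parts of a regular system of parameters** (`IsRsopPart` form): `y : Fin (a + b) → R`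
part of a regular system of parameters, `𝔮` generated by its first `a` members, `P` by all of them. [cite: Matsumura1987, Thm. 16.2] -/
theorem span_inf_pow_succ_eq_mul_pow [IsLocalRing R] {a b : ℕ} {y : Fin (a + b) → R} (hy : IsRsopPart y) (M : ℕ) :
    Ideal.span (Set.range (y ∘ Fin.castAdd b)) ⊓ Ideal.span (Set.range y) ^ (M + 1) =
      Ideal.span (Set.range (y ∘ Fin.castAdd b)) * Ideal.span (Set.range y) ^ M := by
  haveI := hy.isRegularLocalRing
  obtain ⟨e', x, hd, hx, hxy⟩ := hy.exists_rsop
  have hyx : y = x ∘ Fin.castAdd e' := funext fun i => (hxy i).symm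
  subst hyx
  exact span_inf_pow_succ_eq_mul_pow_rsop hd x hx (Fin.castAdd e') (Fin.castAdd_injective _ _) M

/-- **`(z) ∩ 𝔪^{M+1} = (z)·𝔪^M`** for a part `z` of a regular system of parameters of a regular local ring.
[cite: Matsumura1987, Thm. 16.2] -/
theorem span_inf_maximalIdeal_pow_succ_eq [IsLocalRing R] {n : ℕ} {z : Fin n → R} (hz : IsRsopPart z) (M : ℕ) :
    Ideal.span (Set.range z) ⊓ maximalIdeal R ^ (M + 1) = Ideal.span (Set.range z) * maximalIdeal R ^ M := by
  haveI := hz.isRegularLocalRing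
  obtain ⟨e', x, hd, hx, hxz⟩ := hz.exists_rsop
  have hzx : z = x ∘ Fin.castAdd e' := funext fun i => (hxz i).symm
  subst hzx
  have h := span_inf_pow_succ_eq_mul_pow_rsop hd x hx (id : Fin (n + e') → Fin (n + e')) Function.injective_id M
  simpa [Function.comp_id, hx] using h

end Summit.ResolutionOfSingularities.ResolutionOfSingularities.Theorems.SwitchingDichotomy.RsopNested

end
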